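import Summits.AtomisticToContinuum.HydrodynamicLimit.Theorems.InformationPercolationEngineChaosClosesEulerReadoutModulus
import Summits.AtomisticToContinuum.HydrodynamicLimit.Theorems.InformationPercolationEngineKineticClosureBridge
import Literature.MathematicalPhysics.KineticTheory.HardSphereBBGKYLiouvilleFlow
import Summits.AtomisticToContinuum.HydrodynamicLimit.Theorems.JParityClosureDensityCapMeanDisplacement
import HarnessLib

/-!
# Weak readout at the instant `t` (crux `ChaosClosesEuler`, stmt-AtomisticToContinuum-15141, line `Sketch`,
# stub `stub_readout`) — helper 5b: the three pathwise chains

WHAT. Along ONE good orbit `s ↦ Φ_s z`, for one smooth test `b` and one instant `s₀ ≥ t` of the window, the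
four-link chains `tested field at t → tested field at s₀ → b-tested mollified field at s₀ → b ∫ Euler field at s₀
→ at t` for the density (`density_chain`: positions are Lipschitz in time, `stub_meanDisplacement`), the momentum
(`momentum_chain`: one Cartesian component at a time, the time-modulus of helper 1) and the energy (`energy_chain`),
with the cone-smoothing commutators of `KineticClosureBridge`, the `L¹(dx)` error at `s₀` and the time continuity of
the Euler field as inputs; `cubic_window_le` — the windowed cubic moment against the conserved energy and the cubic
tail `(N+1)⁻¹ Σᵢ ‖vᵢ‖³ 1{‖vᵢ‖ > M}` (VERBATIM the integrand of `TwoClocks.EnergyCurrentTails`; measurable,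
nonnegative, interval integrable along good orbits, `Σᵢ ‖vᵢ‖³ ≤ M⁺ · 2E + tail`); the bookkeeping between the
route's tested fields and the library's `momentumObservable` / `energyObservable`, and `‖v‖ ≤ Σ_k |v_k|` on `ℝ³`
(the registered sub-goal `stub_readoutFields`).

No named fact is invoked.
-/

noncomputable section

namespace Summit.AtomisticToContinuum.HydrodynamicLimit.Theorems.ChaosClosesEulerReadout

open scoped BigOperators Topology Classical MeasureTheory ENNReal InnerProductSpace
open Filter Set MeasureTheory Function
open Literature.MathematicalPhysics.KineticTheory
open Literature.Analysis.FluidPDE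
open Literature.Analysis.FunctionSpaces
open Summit.AtomisticToContinuum.HydrodynamicLimit.Theorems.DensityCapNegative
  (cone cone_nonneg cone_le mollDensity_eq mollDensity_nonneg mollDensity_le)
open Summit.AtomisticToContinuum.HydrodynamicLimit.Theorems.KineticClosureDensity
  (continuous_cone_right continuous_mollDensity abs_empiricalDensityField_sub_integral_mul_mollDensity_le)
open Summit.AtomisticToContinuum.HydrodynamicLimit.Theorems.KineticClosureBridge
  (meanSpeed_le meanEnergy_eq norm_empiricalMomentumField_sub_integral_smul_le
    abs_empiricalEnergyField_sub_integral_mul_le continuous_mollMomentum continuous_mollEnergy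
    norm_integral_smul_sub_le abs_integral_mul_sub_le)

/-! ## §1 Components, observables, the cubic tail -/

/-- **Registered sub-goal `stub_readoutFields` (helper 4 of `stub_readout`).** On `ℝ³` the Euclidean norm is at
most the sum of the absolute values of the coordinates (the momentum field is read one Cartesian component at a
time). [folklore] -/
theorem stub_readoutFields : ∀ v : V3, ‖v‖ ≤ ∑ k, |v k| := by
  intro v
  rw [EuclideanSpace.norm_eq, Fin.sum_univ_three, Fin.sum_univ_three]
  simp only [Real.norm_eq_abs, sq_abs]
  rw [Real.sqrt_le_left (by positivity)]
  nlinarith [abs_nonneg (v 0), abs_nonneg (v 1), abs_nonneg (v 2), sq_abs (v 0), sq_abs (v 1), sq_abs (v 2)]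

/-- The momentum observable of the vector test `χ • e_k` is `Σᵢ χ(xᵢ) vᵢₖ`. [folklore] -/
theorem momentumObservable_smul_single {n : ℕ} (χ : T3 → ℝ) (k : Fin 3) (w : Config n (Fin 3) T3) :
    momentumObservable (fun x => χ x • EuclideanSpace.single k (1 : ℝ)) w = ∑ i, χ (w i).1 * (w i).2 k := by
  unfold momentumObservable
  refine Finset.sum_congr rfl fun i _ => ?_
  rw [inner_smul_left, EuclideanSpace.inner_single_left]
  simp

/-- A Cartesian component of the `χ`-tested empirical momentum field is the normalised momentum observable of
`χ • e_k`, `N⁻¹ Σᵢ χ(xᵢ) vᵢₖ`. [folklore] -/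
theorem empiricalMomentumField_apply_eq_momentumObservable {n : ℕ} (w : Config n (Fin 3) T3) (χ : T3 → ℝ)
    (k : Fin 3) :
    empiricalMomentumField w χ k = (n : ℝ)⁻¹ * momentumObservable (fun x => χ x • EuclideanSpace.single k (1 : ℝ)) w := by
  rw [empiricalMomentumField_eq_sum, momentumObservable_smul_single]
  simp [Finset.sum_apply]

/-- The `χ`-tested empirical energy field is the normalised energy observable. [folklore] -/
theorem empiricalEnergyField_eq_energyObservable {n : ℕ} (w : Config n (Fin 3) T3) (χ : T3 → ℝ) :
    empiricalEnergyField w χ = (n : ℝ)⁻¹ * energyObservable χ w := by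
  rw [empiricalEnergyField_eq_sum]
  rfl

/-- The single-particle cubic tail is between `0` and `‖v‖³`. [folklore] -/
theorem indicator_cube_mem (M : ℝ) (v : V3) :
    0 ≤ Set.indicator {v : V3 | M < ‖v‖} (fun v => ‖v‖ ^ 3) v ∧
      Set.indicator {v : V3 | M < ‖v‖} (fun v => ‖v‖ ^ 3) v ≤ ‖v‖ ^ 3 := by
  by_cases h : v ∈ {v : V3 | M < ‖v‖}
  · rw [Set.indicator_of_mem h]
    exact ⟨by positivity, le_rfl⟩
  · rw [Set.indicator_of_notMem h]
    exact ⟨le_rfl, by positivity⟩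

/-- The cubic tail observable `(N+1)⁻¹ Σᵢ ‖vᵢ‖³ 1{‖vᵢ‖ > M}` (verbatim the integrand of
`TwoClocks.EnergyCurrentTails`) is nonnegative. [folklore] -/
theorem cubicTail_nonneg (M : ℝ) {N : ℕ} (w : Config (N + 1) (Fin 3) T3) :
    0 ≤ ((N : ℝ) + 1)⁻¹ * ∑ i : Fin (N + 1), Set.indicator {v : V3 | M < ‖v‖} (fun v => ‖v‖ ^ 3) ((w i).2) :=
  mul_nonneg (inv_nonneg.2 (by positivity)) (Finset.sum_nonneg fun i _ => (indicator_cube_mem M _).1)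

/-- The cubic tail observable is measurable. [folklore] -/
theorem measurable_cubicTail (M : ℝ) (N : ℕ) : Measurable fun w : Config (N + 1) (Fin 3) T3 =>
    ((N : ℝ) + 1)⁻¹ * ∑ i : Fin (N + 1), Set.indicator {v : V3 | M < ‖v‖} (fun v => ‖v‖ ^ 3) ((w i).2) := by
  refine measurable_const.mul (Finset.measurable_sum _ fun i _ => ?_)
  have hS : MeasurableSet {v : V3 | M < ‖v‖} := (isOpen_lt continuous_const continuous_norm).measurableSet
  have hv : Measurable fun w : Config (N + 1) (Fin 3) T3 => (w i).2 := (measurable_pi_apply i).snd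
  exact ((continuous_norm.pow 3).measurable.indicator hS).comp hv

/-- **Truncation of the cubic moment**: `Σᵢ ‖vᵢ‖³ ≤ M⁺ · 2E(w) + Σᵢ ‖vᵢ‖³ 1{‖vᵢ‖ > M}`. [folklore] -/
theorem sum_norm_cube_le (M : ℝ) {N : ℕ} (w : Config (N + 1) (Fin 3) T3) :
    ∑ i, ‖(w i).2‖ ^ 3 ≤ max M 0 * (2 * configEnergy w) +
      ∑ i : Fin (N + 1), Set.indicator {v : V3 | M < ‖v‖} (fun v => ‖v‖ ^ 3) ((w i).2) := by
  have h1 : 2 * configEnergy w = ∑ i, ‖(w i).2‖ ^ 2 := by unfold configEnergy; ring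
  rw [h1, Finset.mul_sum, ← Finset.sum_add_distrib]
  refine Finset.sum_le_sum fun i _ => ?_
  by_cases h : (w i).2 ∈ {v : V3 | M < ‖v‖}
  · rw [Set.indicator_of_mem h]
    nlinarith [le_max_right M 0, sq_nonneg ‖(w i).2‖]
  · rw [Set.indicator_of_notMem h, add_zero]
    have hle : ‖(w i).2‖ ≤ max M 0 := (not_lt.1 h).trans (le_max_left _ _)
    calc ‖(w i).2‖ ^ 3 = ‖(w i).2‖ * ‖(w i).2‖ ^ 2 := by ring
      _ ≤ max M 0 * ‖(w i).2‖ ^ 2 := mul_le_mul_of_nonneg_right hle (sq_nonneg _)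

/-- Along a good orbit the cubic tail observable is interval integrable in time (measurable and bounded by the
conserved energy). [folklore] -/
theorem intervalIntegrable_cubicTail_flow {N : ℕ} {ε : ℝ} (Φ : HardSphereFlow (Torus.geometry (Fin 3)) ε (N + 1))
    (M : ℝ) {z : Config (N + 1) (Fin 3) T3} (hz : z ∈ Φ.good) (a b : ℝ) :
    IntervalIntegrable (fun u => ((N : ℝ) + 1)⁻¹ *
      ∑ i : Fin (N + 1), Set.indicator {v : V3 | M < ‖v‖} (fun v => ‖v‖ ^ 3) ((Φ.flow u z i).2)) volume a b := by
  have hγ := Φ.isTrajectory z hz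
  have hmeas : Measurable fun u => ((N : ℝ) + 1)⁻¹ *
      ∑ i : Fin (N + 1), Set.indicator {v : V3 | M < ‖v‖} (fun v => ‖v‖ ^ 3) ((Φ.flow u z i).2) :=
    (measurable_cubicTail M N).comp hγ.measurable_torus
  have hbound : ∀ u, ‖((N : ℝ) + 1)⁻¹ *
      ∑ i : Fin (N + 1), Set.indicator {v : V3 | M < ‖v‖} (fun v => ‖v‖ ^ 3) ((Φ.flow u z i).2)‖ ≤
      ((N : ℝ) + 1)⁻¹ * (((N + 1 : ℕ) : ℝ) * Real.sqrt (2 * configEnergy z) ^ 3) := by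
    intro u
    rw [Real.norm_eq_abs, abs_of_nonneg (cubicTail_nonneg M _)]
    refine mul_le_mul_of_nonneg_left ?_ (inv_nonneg.2 (by positivity))
    have hE : configEnergy (Φ.flow u z) = configEnergy z := Φ.configEnergy_flow hz u
    calc ∑ i, Set.indicator {v : V3 | M < ‖v‖} (fun v => ‖v‖ ^ 3) ((Φ.flow u z i).2)
        ≤ ∑ _i : Fin (N + 1), Real.sqrt (2 * configEnergy z) ^ 3 := Finset.sum_le_sum fun i _ => by
          refine (indicator_cube_mem M _).2.trans (pow_le_pow_left₀ (norm_nonneg _) ?_ 3)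
          rw [← hE, ← Real.sqrt_sq (norm_nonneg (Φ.flow u z i).2)]
          exact Real.sqrt_le_sqrt (norm_vel_sq_le_two_mul_configEnergy _ i)
      _ = ((N + 1 : ℕ) : ℝ) * Real.sqrt (2 * configEnergy z) ^ 3 := by
          rw [Finset.sum_const, Finset.card_univ, Fintype.card_fin, nsmul_eq_mul]
  refine (Measure.integrableOn_of_bounded ?_ hmeas.aestronglyMeasurable (ae_of_all _ hbound)).intervalIntegrable
  rw [Real.volume_interval]
  exact ENNReal.ofReal_ne_top

/-! ## §4 The three chains -/

/-- **Registered sub-goal `stub_readoutChains` (helper 5b of `stub_readout`).** The integral over the torus (Haar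
probability measure) of a function bounded by `C` has norm at most `C` — the Euler-side link of the three chains.
[folklore] -/
theorem stub_readoutChains : ∀ {F : Type} [NormedAddCommGroup F] [NormedSpace ℝ F] {f : T3 → F} {C : ℝ}, (∀ x, ‖f x‖ ≤ C) → ‖∫ x, f x‖ ≤ C := by
  intro F _ _ f C h
  have h1 := norm_integral_le_of_norm_le_const (μ := (volume : Measure T3)) (ae_of_all _ h)
  rwa [probReal_univ, mul_one] at h1

/-- **DENSITY chain.** `|D_b(t) − ∫ b ρ(t)| ≤ L√(2Ē)|t − s₀| + ω_b(r) + L · e_ρ(s₀) + L · e_U`. [folklore] -/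
theorem density_chain {N : ℕ} {ε : ℝ} (Φ : HardSphereFlow (Torus.geometry (Fin 3)) ε (N + 1))
    {z : Config (N + 1) (Fin 3) T3} (hz : z ∈ Φ.good) {b : T3 → ℝ} (hbc : Continuous b) {L : ℝ} (hL0 : 0 ≤ L)
    (hbC : ∀ x, |b x| ≤ L) (hbLip : ∀ x y, |b x - b y| ≤ L * Torus.euclidDist x y) {r : ℝ} (hr : 0 < r)
    (hr2 : r ≤ 1 / 2) {ωr : ℝ} (hmod : ∀ x y, Torus.euclidDist x y < r → |b x - b y| ≤ ωr) {t s₀ : ℝ}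
    {ρ : ℝ → T3 → ℝ} (hρs : Continuous (ρ s₀)) (hρt : Continuous (ρ t)) {eU : ℝ} (hU : ∀ x, |ρ s₀ x - ρ t x| ≤ eU) :
    |empiricalDensityField (Φ.flow t z) b - ∫ x, b x * ρ t x| ≤
      L * Real.sqrt (2 * (((N + 1 : ℕ) : ℝ)⁻¹ * configEnergy z)) * |t - s₀| + ωr +
      L * (∫ x, |empiricalDensityField (Φ.flow s₀ z) (fun y => cone r y x) - ρ s₀ x|) + L * eU := by
  have hn : (0 : ℝ) < ((N + 1 : ℕ) : ℝ) := by positivity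
  -- d1: time modulus (positions are Lipschitz in time)
  have d1 : |empiricalDensityField (Φ.flow t z) b - empiricalDensityField (Φ.flow s₀ z) b| ≤
      L * Real.sqrt (2 * (((N + 1 : ℕ) : ℝ)⁻¹ * configEnergy z)) * |t - s₀| := by
    rw [empiricalDensityField_eq_sum, empiricalDensityField_eq_sum, ← mul_sub, abs_mul,
      abs_of_nonneg (inv_nonneg.2 hn.le)]
    calc ((N + 1 : ℕ) : ℝ)⁻¹ * |∑ i, b (Φ.flow t z i).1 - ∑ i, b (Φ.flow s₀ z i).1|
        ≤ ((N + 1 : ℕ) : ℝ)⁻¹ * (L * ∑ i, Torus.euclidDist (Φ.flow t z i).1 (Φ.flow s₀ z i).1) :=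
          mul_le_mul_of_nonneg_left (stub_readoutModulus hbLip _ _) (inv_nonneg.2 hn.le)
      _ = L * (((N + 1 : ℕ) : ℝ)⁻¹ * ∑ i, Torus.euclidDist (Φ.flow t z i).1 (Φ.flow s₀ z i).1) := by ring
      _ ≤ L * (Real.sqrt (2 * (((N + 1 : ℕ) : ℝ)⁻¹ * configEnergy z)) * |t - s₀|) :=
          mul_le_mul_of_nonneg_left (stub_meanDisplacement Φ hz s₀ t) hL0
      _ = _ := by ring
  -- d2: cone smoothing
  have d2 := abs_empiricalDensityField_sub_integral_mul_mollDensity_le hr hr2 hbc hmod (Nat.succ_ne_zero N)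
    (Φ.flow s₀ z)
  -- d3: the L¹ error at s₀
  have d3 : |(∫ x, b x * DensityCapNegative.mollDensity r (Φ.flow s₀ z) x) - ∫ x, b x * ρ s₀ x| ≤
      L * ∫ x, |empiricalDensityField (Φ.flow s₀ z) (fun y => cone r y x) - ρ s₀ x| :=
    abs_integral_mul_sub_le hbc hbC (continuous_mollDensity r _) hρs
  -- d4: Euler time continuity
  have d4 : |(∫ x, b x * ρ s₀ x) - ∫ x, b x * ρ t x| ≤ L * eU := by
    rw [← integral_sub (integrable_of_continuous_T3 (g := fun x => b x * ρ s₀ x) (hbc.mul hρs))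
      (integrable_of_continuous_T3 (g := fun x => b x * ρ t x) (hbc.mul hρt)),
      ← Real.norm_eq_abs]
    refine stub_readoutChains fun x => ?_
    rw [Real.norm_eq_abs, ← mul_sub, abs_mul]
    exact mul_le_mul (hbC x) (hU x) (abs_nonneg _) hL0
  calc |empiricalDensityField (Φ.flow t z) b - ∫ x, b x * ρ t x|
      ≤ |empiricalDensityField (Φ.flow t z) b - empiricalDensityField (Φ.flow s₀ z) b| +
        (|empiricalDensityField (Φ.flow s₀ z) b - ∫ x, b x * DensityCapNegative.mollDensity r (Φ.flow s₀ z) x| +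
        (|(∫ x, b x * DensityCapNegative.mollDensity r (Φ.flow s₀ z) x) - ∫ x, b x * ρ s₀ x| +
        |(∫ x, b x * ρ s₀ x) - ∫ x, b x * ρ t x|)) :=
        (abs_sub_le _ _ _).trans (add_le_add le_rfl ((abs_sub_le _ _ _).trans (add_le_add le_rfl (abs_sub_le _ _ _))))
    _ ≤ _ := by linarith [d1, d2, d3, d4]

/-- **MOMENTUM chain.** With the vector tests `J_k = b • e_k`:
`‖M_b(t) − ∫ b • m(t)‖ ≤ 3(L·2Ē·(s₀ − t) + (L/2)(ε/(N+1))·K^{(t,s₀]}[1 + |vᵢ|² + |vⱼ|²]) + ω_b(r)(1/2 + Ē) + L·e_m(s₀) + L·e_U`.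
[folklore] -/
theorem momentum_chain {N : ℕ} {σ : ℝ} (Φ : HardSphereFlow (Torus.geometry (Fin 3)) (hsDiameter σ N) (N + 1))
    (hG : (Torus.geometry (Fin 3)).IsHardSphereRegular (hsDiameter σ N))
    {z : Config (N + 1) (Fin 3) T3} (hz : z ∈ Φ.good) {b : T3 → ℝ} (hbc : Continuous b) {L : ℝ} (hL0 : 0 ≤ L)
    (hbC : ∀ x, |b x| ≤ L)
    (hJ : ∀ k : Fin 3, Torus.IsContDiff 1 (fun x => b x • EuclideanSpace.single k (1 : ℝ)) ∧
      (∀ x, ‖Torus.fderiv (fun x => b x • EuclideanSpace.single k (1 : ℝ)) x‖ ≤ L) ∧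
      (∀ x y, ‖b x • EuclideanSpace.single k (1 : ℝ) - b y • EuclideanSpace.single k (1 : ℝ)‖ ≤
        L * Torus.euclidDist x y))
    {r : ℝ} (hr : 0 < r) (hr2 : r ≤ 1 / 2) {ωr : ℝ} (hω0 : 0 ≤ ωr)
    (hmod : ∀ x y, Torus.euclidDist x y < r → |b x - b y| ≤ ωr) {t s₀ : ℝ} (hts : t ≤ s₀)
    {m : ℝ → T3 → V3} (hms : Continuous (m s₀)) (hmt : Continuous (m t)) {eU : ℝ} (hU : ∀ x, ‖m s₀ x - m t x‖ ≤ eU) :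
    ‖empiricalMomentumField (Φ.flow t z) b - ∫ x, b x • m t x‖ ≤
      3 * (L * (2 * (((N + 1 : ℕ) : ℝ)⁻¹ * configEnergy z)) * (s₀ - t) +
        L / 2 * (hsDiameter σ N / ((N + 1 : ℕ) : ℝ) * collisionPairSum (Torus.geometry (Fin 3)) (hsDiameter σ N) (fun s => Φ.flow s z) (Set.Ioc t s₀)
          (fun s i j => 1 + ‖(Φ.flow s z i).2‖ ^ 2 + ‖(Φ.flow s z j).2‖ ^ 2))) +
      ωr * (1 / 2 + ((N + 1 : ℕ) : ℝ)⁻¹ * configEnergy z) +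
      L * (∫ x, ‖empiricalMomentumField (Φ.flow s₀ z) (fun y => cone r y x) - m s₀ x‖) + L * eU := by
  have hn : (0 : ℝ) < ((N + 1 : ℕ) : ℝ) := by positivity
  have hγ : IsHardSphereTrajectory (Torus.geometry (Fin 3)) (hsDiameter σ N) (N + 1) (fun s => Φ.flow s z) :=
    Φ.isTrajectory z hz
  have hEs : ∀ s, configEnergy (Φ.flow s z) = configEnergy z := fun s => Φ.configEnergy_flow hz s
  -- m1: time modulus, component by component
  have m1 : ‖empiricalMomentumField (Φ.flow t z) b - empiricalMomentumField (Φ.flow s₀ z) b‖ ≤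
      3 * (L * (2 * (((N + 1 : ℕ) : ℝ)⁻¹ * configEnergy z)) * (s₀ - t) +
        L / 2 * (hsDiameter σ N / ((N + 1 : ℕ) : ℝ) *
          collisionPairSum (Torus.geometry (Fin 3)) (hsDiameter σ N) (fun s => Φ.flow s z) (Set.Ioc t s₀)
          (fun s i j => 1 + ‖(Φ.flow s z i).2‖ ^ 2 + ‖(Φ.flow s z j).2‖ ^ 2))) := by
    refine (stub_readoutFields _).trans ?_
    have hk : ∀ k : Fin 3, |(empiricalMomentumField (Φ.flow t z) b - empiricalMomentumField (Φ.flow s₀ z) b) k| ≤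
        L * (2 * (((N + 1 : ℕ) : ℝ)⁻¹ * configEnergy z)) * (s₀ - t) +
        L / 2 * (hsDiameter σ N / ((N + 1 : ℕ) : ℝ) *
          collisionPairSum (Torus.geometry (Fin 3)) (hsDiameter σ N) (fun s => Φ.flow s z) (Set.Ioc t s₀)
          (fun s i j => 1 + ‖(Φ.flow s z i).2‖ ^ 2 + ‖(Φ.flow s z j).2‖ ^ 2)) := by
      intro k
      obtain ⟨hJ1, hJD, hJL⟩ := hJ k
      rw [PiLp.sub_apply, empiricalMomentumField_apply_eq_momentumObservable,
        empiricalMomentumField_apply_eq_momentumObservable, ← mul_sub, abs_mul, abs_of_nonneg (inv_nonneg.2 hn.le),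
        abs_sub_comm]
      have h := abs_momentumObservable_sub_le hγ hG hJ1 hJD hL0 hJL hts
      rw [hEs t] at h
      calc ((N + 1 : ℕ) : ℝ)⁻¹ * |momentumObservable (fun x => b x • EuclideanSpace.single k (1 : ℝ)) (Φ.flow s₀ z) -
            momentumObservable (fun x => b x • EuclideanSpace.single k (1 : ℝ)) (Φ.flow t z)|
          ≤ ((N + 1 : ℕ) : ℝ)⁻¹ * (L * (2 * configEnergy z) * (s₀ - t) + L * hsDiameter σ N / 2 *
              collisionPairSum (Torus.geometry (Fin 3)) (hsDiameter σ N) (fun s => Φ.flow s z) (Set.Ioc t s₀)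
          (fun s i j => 1 + ‖(Φ.flow s z i).2‖ ^ 2 + ‖(Φ.flow s z j).2‖ ^ 2)) :=
            mul_le_mul_of_nonneg_left h (inv_nonneg.2 hn.le)
        _ = _ := by
            field_simp
    calc ∑ k, |(empiricalMomentumField (Φ.flow t z) b - empiricalMomentumField (Φ.flow s₀ z) b) k|
        ≤ ∑ _k : Fin 3, (L * (2 * (((N + 1 : ℕ) : ℝ)⁻¹ * configEnergy z)) * (s₀ - t) +
          L / 2 * (hsDiameter σ N / ((N + 1 : ℕ) : ℝ) *
            collisionPairSum (Torus.geometry (Fin 3)) (hsDiameter σ N) (fun s => Φ.flow s z) (Set.Ioc t s₀)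
          (fun s i j => 1 + ‖(Φ.flow s z i).2‖ ^ 2 + ‖(Φ.flow s z j).2‖ ^ 2))) := Finset.sum_le_sum fun k _ => hk k
      _ = _ := by rw [Finset.sum_const, Finset.card_univ, Fintype.card_fin, nsmul_eq_mul]; norm_num
  -- m2: cone smoothing
  have m2 : ‖empiricalMomentumField (Φ.flow s₀ z) b -
      ∫ x, b x • empiricalMomentumField (Φ.flow s₀ z) (fun y => cone r y x)‖ ≤
      ωr * (1 / 2 + ((N + 1 : ℕ) : ℝ)⁻¹ * configEnergy z) := by
    refine (norm_empiricalMomentumField_sub_integral_smul_le hr hr2 hbc hmod (Φ.flow s₀ z)).trans ?_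
    refine mul_le_mul_of_nonneg_left ?_ hω0
    have h := meanSpeed_le (Φ.flow s₀ z)
    rwa [hEs s₀] at h
  -- m3: the L¹ error at s₀
  have m3 : ‖(∫ x, b x • empiricalMomentumField (Φ.flow s₀ z) (fun y => cone r y x)) - ∫ x, b x • m s₀ x‖ ≤
      L * ∫ x, ‖empiricalMomentumField (Φ.flow s₀ z) (fun y => cone r y x) - m s₀ x‖ :=
    norm_integral_smul_sub_le hbc hbC (continuous_mollMomentum r _) hms
  -- m4: Euler time continuity
  have m4 : ‖(∫ x, b x • m s₀ x) - ∫ x, b x • m t x‖ ≤ L * eU := by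
    rw [← integral_sub (integrable_of_continuous_T3 (g := fun x => b x • m s₀ x) (hbc.smul hms))
      (integrable_of_continuous_T3 (g := fun x => b x • m t x) (hbc.smul hmt))]
    refine stub_readoutChains fun x => ?_
    rw [← smul_sub, norm_smul, Real.norm_eq_abs]
    exact mul_le_mul (hbC x) (hU x) (norm_nonneg _) hL0
  calc ‖empiricalMomentumField (Φ.flow t z) b - ∫ x, b x • m t x‖
      ≤ ‖empiricalMomentumField (Φ.flow t z) b - empiricalMomentumField (Φ.flow s₀ z) b‖ +
        (‖empiricalMomentumField (Φ.flow s₀ z) b -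
          ∫ x, b x • empiricalMomentumField (Φ.flow s₀ z) (fun y => cone r y x)‖ +
        (‖(∫ x, b x • empiricalMomentumField (Φ.flow s₀ z) (fun y => cone r y x)) - ∫ x, b x • m s₀ x‖ +
        ‖(∫ x, b x • m s₀ x) - ∫ x, b x • m t x‖)) :=
        (norm_sub_le_norm_sub_add_norm_sub _ _ _).trans (add_le_add le_rfl
          ((norm_sub_le_norm_sub_add_norm_sub _ _ _).trans (add_le_add le_rfl
            (norm_sub_le_norm_sub_add_norm_sub _ _ _))))
    _ ≤ _ := by linarith [m1, m2, m3, m4]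

/-- **ENERGY chain.**
`|E_b(t) − ∫ b E(t)| ≤ (L/2)(N+1)⁻¹∫_t^{s₀}Σ‖vᵢ‖³ + (L/2)(ε/(N+1))·K^{(t,s₀]}[1 + |vᵢ|² + |vⱼ|²] + ω_b(r)Ē + L·e_E(s₀) + L·e_U`.
[folklore] -/
theorem energy_chain {N : ℕ} {σ : ℝ} (Φ : HardSphereFlow (Torus.geometry (Fin 3)) (hsDiameter σ N) (N + 1))
    (hG : (Torus.geometry (Fin 3)).IsHardSphereRegular (hsDiameter σ N))
    {z : Config (N + 1) (Fin 3) T3} (hz : z ∈ Φ.good) {b : T3 → ℝ} (hbc : Continuous b) {L : ℝ} (hL0 : 0 ≤ L)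
    (hbC : ∀ x, |b x| ≤ L) (hbLip : ∀ x y, |b x - b y| ≤ L * Torus.euclidDist x y) (hb1 : Torus.IsContDiff 1 b)
    (hbD : ∀ x, ‖Torus.fderiv b x‖ ≤ L) {r : ℝ} (hr : 0 < r) (hr2 : r ≤ 1 / 2) {ωr : ℝ}
    (hmod : ∀ x y, Torus.euclidDist x y < r → |b x - b y| ≤ ωr) {t s₀ : ℝ} (hts : t ≤ s₀)
    {e : ℝ → T3 → ℝ} (hes : Continuous (e s₀)) (het : Continuous (e t)) {eU : ℝ} (hU : ∀ x, |e s₀ x - e t x| ≤ eU) :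
    |empiricalEnergyField (Φ.flow t z) b - ∫ x, b x * e t x| ≤
      L / 2 * (((N + 1 : ℕ) : ℝ)⁻¹ * ∫ u' in t..s₀, ∑ i, ‖(Φ.flow u' z i).2‖ ^ 3) +
      L / 2 * (hsDiameter σ N / ((N + 1 : ℕ) : ℝ) * collisionPairSum (Torus.geometry (Fin 3)) (hsDiameter σ N) (fun s => Φ.flow s z) (Set.Ioc t s₀)
          (fun s i j => 1 + ‖(Φ.flow s z i).2‖ ^ 2 + ‖(Φ.flow s z j).2‖ ^ 2)) +
      ωr * (((N + 1 : ℕ) : ℝ)⁻¹ * configEnergy z) +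
      L * (∫ x, |empiricalEnergyField (Φ.flow s₀ z) (fun y => cone r y x) - e s₀ x|) + L * eU := by
  have hn : (0 : ℝ) < ((N + 1 : ℕ) : ℝ) := by positivity
  have hγ : IsHardSphereTrajectory (Torus.geometry (Fin 3)) (hsDiameter σ N) (N + 1) (fun s => Φ.flow s z) :=
    Φ.isTrajectory z hz
  have hEs : ∀ s, configEnergy (Φ.flow s z) = configEnergy z := fun s => Φ.configEnergy_flow hz s
  -- e1: time modulus
  have e1 : |empiricalEnergyField (Φ.flow t z) b - empiricalEnergyField (Φ.flow s₀ z) b| ≤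
      L / 2 * (((N + 1 : ℕ) : ℝ)⁻¹ * ∫ u' in t..s₀, ∑ i, ‖(Φ.flow u' z i).2‖ ^ 3) +
      L / 2 * (hsDiameter σ N / ((N + 1 : ℕ) : ℝ) *
        collisionPairSum (Torus.geometry (Fin 3)) (hsDiameter σ N) (fun s => Φ.flow s z) (Set.Ioc t s₀)
          (fun s i j => 1 + ‖(Φ.flow s z i).2‖ ^ 2 + ‖(Φ.flow s z j).2‖ ^ 2)) := by
    rw [empiricalEnergyField_eq_energyObservable, empiricalEnergyField_eq_energyObservable, ← mul_sub, abs_mul,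
      abs_of_nonneg (inv_nonneg.2 hn.le), abs_sub_comm]
    have h := abs_energyObservable_sub_le hγ hG hb1 hbD hL0 hbLip hts
    calc ((N + 1 : ℕ) : ℝ)⁻¹ * |energyObservable b (Φ.flow s₀ z) - energyObservable b (Φ.flow t z)|
        ≤ ((N + 1 : ℕ) : ℝ)⁻¹ * (L / 2 * (∫ u' in t..s₀, ∑ i, ‖(Φ.flow u' z i).2‖ ^ 3) +
            L * hsDiameter σ N / 2 * collisionPairSum (Torus.geometry (Fin 3)) (hsDiameter σ N) (fun s => Φ.flow s z) (Set.Ioc t s₀)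
          (fun s i j => 1 + ‖(Φ.flow s z i).2‖ ^ 2 + ‖(Φ.flow s z j).2‖ ^ 2)) :=
          mul_le_mul_of_nonneg_left h (inv_nonneg.2 hn.le)
      _ = _ := by
          field_simp
  -- e2: cone smoothing
  have e2 : |empiricalEnergyField (Φ.flow s₀ z) b -
      ∫ x, b x * empiricalEnergyField (Φ.flow s₀ z) (fun y => cone r y x)| ≤
      ωr * (((N + 1 : ℕ) : ℝ)⁻¹ * configEnergy z) := by
    refine (abs_empiricalEnergyField_sub_integral_mul_le hr hr2 hbc hmod (Φ.flow s₀ z)).trans ?_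
    rw [meanEnergy_eq, hEs s₀]
  -- e3: the L¹ error at s₀
  have e3 : |(∫ x, b x * empiricalEnergyField (Φ.flow s₀ z) (fun y => cone r y x)) - ∫ x, b x * e s₀ x| ≤
      L * ∫ x, |empiricalEnergyField (Φ.flow s₀ z) (fun y => cone r y x) - e s₀ x| :=
    abs_integral_mul_sub_le hbc hbC (continuous_mollEnergy r _) hes
  -- e4: Euler time continuity
  have e4 : |(∫ x, b x * e s₀ x) - ∫ x, b x * e t x| ≤ L * eU := by
    rw [← integral_sub (integrable_of_continuous_T3 (g := fun x => b x * e s₀ x) (hbc.mul hes))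
      (integrable_of_continuous_T3 (g := fun x => b x * e t x) (hbc.mul het)),
      ← Real.norm_eq_abs]
    refine stub_readoutChains fun x => ?_
    rw [Real.norm_eq_abs, ← mul_sub, abs_mul]
    exact mul_le_mul (hbC x) (hU x) (abs_nonneg _) hL0
  calc |empiricalEnergyField (Φ.flow t z) b - ∫ x, b x * e t x|
      ≤ |empiricalEnergyField (Φ.flow t z) b - empiricalEnergyField (Φ.flow s₀ z) b| +
        (|empiricalEnergyField (Φ.flow s₀ z) b - ∫ x, b x * empiricalEnergyField (Φ.flow s₀ z) (fun y => cone r y x)| +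
        (|(∫ x, b x * empiricalEnergyField (Φ.flow s₀ z) (fun y => cone r y x)) - ∫ x, b x * e s₀ x| +
        |(∫ x, b x * e s₀ x) - ∫ x, b x * e t x|)) :=
        (abs_sub_le _ _ _).trans (add_le_add le_rfl ((abs_sub_le _ _ _).trans (add_le_add le_rfl (abs_sub_le _ _ _))))
    _ ≤ _ := by linarith [e1, e2, e3, e4]

/-- **The windowed cubic moment against the conserved energy and the cubic tail**: for `t ≤ s₀ ≤ t + Δ`,
`(N+1)⁻¹ ∫_t^{s₀} Σᵢ‖vᵢ‖³ ≤ 2M⁺ Ē Δ + ∫_t^{t+Δ} (N+1)⁻¹ Σᵢ ‖vᵢ‖³ 1{‖vᵢ‖ > M}`. [folklore] -/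
theorem cubic_window_le {N : ℕ} {ε : ℝ} (Φ : HardSphereFlow (Torus.geometry (Fin 3)) ε (N + 1))
    {z : Config (N + 1) (Fin 3) T3} (hz : z ∈ Φ.good) (M : ℝ) {t s₀ Δ : ℝ} (hts : t ≤ s₀) (hs : s₀ ≤ t + Δ) :
    ((N + 1 : ℕ) : ℝ)⁻¹ * ∫ u' in t..s₀, ∑ i, ‖(Φ.flow u' z i).2‖ ^ 3 ≤
      2 * max M 0 * (((N + 1 : ℕ) : ℝ)⁻¹ * configEnergy z) * Δ + ∫ u' in t..(t + Δ), ((N : ℝ) + 1)⁻¹ *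
        ∑ i : Fin (N + 1), Set.indicator {v : V3 | M < ‖v‖} (fun v => ‖v‖ ^ 3) ((Φ.flow u' z i).2) := by
  have hn : (0 : ℝ) < ((N + 1 : ℕ) : ℝ) := by positivity
  have hncast : ((N : ℝ) + 1) = ((N + 1 : ℕ) : ℝ) := by push_cast; ring
  have hγ := Φ.isTrajectory z hz
  have hEs : ∀ s, configEnergy (Φ.flow s z) = configEnergy z := fun s => Φ.configEnergy_flow hz s
  have hcub := intervalIntegrable_sum_norm_vel_pow hγ 3 t (t + Δ)
  have hct := intervalIntegrable_cubicTail_flow Φ M hz t (t + Δ)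
  -- the unnormalised tail is interval integrable too
  have hct' : IntervalIntegrable (fun u' => ∑ i : Fin (N + 1),
      Set.indicator {v : V3 | M < ‖v‖} (fun v => ‖v‖ ^ 3) ((Φ.flow u' z i).2)) volume t (t + Δ) := by
    refine (hct.const_mul ((N : ℝ) + 1)).congr fun u' _ => ?_
    show ((N : ℝ) + 1) * (((N : ℝ) + 1)⁻¹ * _) = _
    rw [← mul_assoc, mul_inv_cancel₀ (by positivity), one_mul]
  -- extend the window
  have h1 : ∫ u' in t..s₀, ∑ i, ‖(Φ.flow u' z i).2‖ ^ 3 ≤ ∫ u' in t..(t + Δ), ∑ i, ‖(Φ.flow u' z i).2‖ ^ 3 :=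
    intervalIntegral.integral_mono_interval le_rfl hts hs
      (ae_of_all _ fun u' => Finset.sum_nonneg fun i _ => by positivity) hcub
  -- truncate
  have h2 : ∫ u' in t..(t + Δ), ∑ i, ‖(Φ.flow u' z i).2‖ ^ 3 ≤
      ∫ u' in t..(t + Δ), (max M 0 * (2 * configEnergy z) +
        ∑ i : Fin (N + 1), Set.indicator {v : V3 | M < ‖v‖} (fun v => ‖v‖ ^ 3) ((Φ.flow u' z i).2)) := by
    refine intervalIntegral.integral_mono_on (by linarith) hcub (intervalIntegrable_const.add hct') fun u' _ => ?_
    have h := sum_norm_cube_le M (Φ.flow u' z)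
    rwa [hEs u'] at h
  have h3 : ∫ u' in t..(t + Δ), (max M 0 * (2 * configEnergy z) +
        ∑ i : Fin (N + 1), Set.indicator {v : V3 | M < ‖v‖} (fun v => ‖v‖ ^ 3) ((Φ.flow u' z i).2)) =
      max M 0 * (2 * configEnergy z) * Δ + ∫ u' in t..(t + Δ),
        ∑ i : Fin (N + 1), Set.indicator {v : V3 | M < ‖v‖} (fun v => ‖v‖ ^ 3) ((Φ.flow u' z i).2) := by
    rw [intervalIntegral.integral_add intervalIntegrable_const hct', intervalIntegral.integral_const, smul_eq_mul]
    ring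
  calc ((N + 1 : ℕ) : ℝ)⁻¹ * ∫ u' in t..s₀, ∑ i, ‖(Φ.flow u' z i).2‖ ^ 3
      ≤ ((N + 1 : ℕ) : ℝ)⁻¹ * (max M 0 * (2 * configEnergy z) * Δ + ∫ u' in t..(t + Δ),
          ∑ i : Fin (N + 1), Set.indicator {v : V3 | M < ‖v‖} (fun v => ‖v‖ ^ 3) ((Φ.flow u' z i).2)) := by
        rw [← h3]
        exact mul_le_mul_of_nonneg_left (h1.trans h2) (inv_nonneg.2 hn.le)
    _ = 2 * max M 0 * (((N + 1 : ℕ) : ℝ)⁻¹ * configEnergy z) * Δ + ((N + 1 : ℕ) : ℝ)⁻¹ * ∫ u' in t..(t + Δ),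
          ∑ i : Fin (N + 1), Set.indicator {v : V3 | M < ‖v‖} (fun v => ‖v‖ ^ 3) ((Φ.flow u' z i).2) := by ring
    _ = _ := by rw [← intervalIntegral.integral_const_mul, hncast]

end Summit.AtomisticToContinuum.HydrodynamicLimit.Theorems.ChaosClosesEulerReadout

end
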